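import Summits.CriticalPhenomena.CardyFormulaZ2.Theses.CardyWhiteToColoured

/-!
# `LimitPayoff` for route CardyWhiteToColoured (item stmt-CriticalPhenomena-4601)

Pure bookkeeping: the noise-flow comparison `NoiseFlowComparison` compares, for every fixed
smoothing width `ℓ`, the bond-ℤ² crossing probabilities `P_δ(R)` at ALL small meshes `δ` with the
SAME continuum quantity `C(ℓ, R)`; hence `δ ↦ P_δ(R)` is Cauchy at `0⁺` and has a limit `Φ R`
(completeness of `ℝ`).  Exact similarity covariance of the continuum family
(`EuclideanCovariance`: `C(‖a‖ ℓ, R') = C(ℓ, R)`) then gives `|Φ R' - Φ R| ≤ 2 ε` for every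
`ε > 0`, i.e. `Φ R' = Φ R`.  `ModelExists` supplies the white noise `μ` and the bump family `k`
at which the two hypotheses are instantiated.
-/

namespace Summit.CriticalPhenomena.CardyFormulaZ2.Theorems.CardyWhiteToColoured

open Filter Set Topology
open Summit.CriticalPhenomena.CardyFormulaZ2.Theses.CardyWhiteToColoured

/-- A real function satisfying the Cauchy condition on right-neighbourhoods of `0` has a
right limit at `0` (completeness of `ℝ`). -/
theorem limitPayoff_exists_tendsto_of_cauchy (u : ℝ → ℝ)
    (h : ∀ ε : ℝ, 0 < ε → ∃ δ₀ : ℝ, 0 < δ₀ ∧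
      ∀ δ : ℝ, 0 < δ → δ < δ₀ → ∀ δ' : ℝ, 0 < δ' → δ' < δ₀ → |u δ - u δ'| < ε) :
    ∃ c : ℝ, Tendsto u (𝓝[>] (0 : ℝ)) (𝓝 c) := by
  rw [← cauchy_map_iff_exists_tendsto, Metric.cauchy_iff]
  refine ⟨NeBot.map inferInstance u, fun ε hε => ?_⟩
  obtain ⟨δ₀, hδ₀, hδ⟩ := h ε hε
  refine ⟨u '' Ioo 0 δ₀, image_mem_map (Ioo_mem_nhdsGT hδ₀), ?_⟩
  rintro _ ⟨δ, ⟨hδpos, hδlt⟩, rfl⟩ _ ⟨δ', ⟨hδ'pos, hδ'lt⟩, rfl⟩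
  rw [Real.dist_eq]
  exact hδ δ hδpos hδlt δ' hδ'pos hδ'lt

/-- Passing to the right limit at `0` in a uniform bound `|u δ - C| < ε` on `(0, δ₀)`. -/
theorem limitPayoff_abs_sub_le_of_tendsto {u : ℝ → ℝ} {c C ε δ₀ : ℝ}
    (hu : Tendsto u (𝓝[>] (0 : ℝ)) (𝓝 c)) (hδ₀ : 0 < δ₀)
    (h : ∀ δ : ℝ, 0 < δ → δ < δ₀ → |u δ - C| < ε) : |c - C| ≤ ε := by
  refine le_of_tendsto ((hu.sub_const C).abs) ?_
  filter_upwards [Ioo_mem_nhdsGT hδ₀] with δ hδ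
  exact (h δ hδ.1 hδ.2).le

/-- Two numbers within `ε / 2` of a common value are within `ε` of each other. -/
theorem limitPayoff_abs_sub_lt_of_near {x y C ε : ℝ} (h1 : |x - C| < ε / 2)
    (h2 : |y - C| < ε / 2) : |x - y| < ε := by
  calc |x - y| ≤ |x - C| + |C - y| := abs_sub_le x C y
    _ = |x - C| + |y - C| := by rw [abs_sub_comm C y]
    _ < ε := by linarith

/-- Two numbers within `ε` of a common value are within `2 ε` of each other. -/
theorem limitPayoff_abs_sub_le_two_mul {x y C ε : ℝ} (h1 : |x - C| ≤ ε) (h2 : |y - C| ≤ ε) :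
    |x - y| ≤ 2 * ε := by
  calc |x - y| ≤ |x - C| + |C - y| := abs_sub_le x C y
    _ = |x - C| + |y - C| := by rw [abs_sub_comm C y]
    _ ≤ 2 * ε := by linarith

/-- **`LimitPayoff`** (item stmt-CriticalPhenomena-4601 of route CardyWhiteToColoured):
`NoiseFlowComparison → EuclideanCovariance → ModelExists →` the bond-ℤ² crossing probability of
every conformal rectangle converges as the mesh goes to `0⁺`, to a similarity-invariant limit
`Φ`.  Proof: Cauchy argument against the common continuum comparison value at a fixed smoothing
width, then exact similarity covariance of the continuum family. -/
theorem limitPayoff_proof :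
    Summit.CriticalPhenomena.CardyFormulaZ2.Theses.CardyWhiteToColoured.LimitPayoff := by
  unfold LimitPayoff
  intro hNFC hEC hME
  unfold ModelExists at hME
  obtain ⟨⟨μ, hμG, hμgen⟩, ⟨k, hk⟩⟩ := hME
  unfold NoiseFlowComparison at hNFC
  unfold EuclideanCovariance at hEC
  have hN := hNFC μ hμG hμgen k hk
  have hE := hEC μ hμG hμgen k hk
  -- Step 1: for every `R` the mesh limit exists (Cauchy at `0⁺`).
  have hlim : ∀ R : Literature.Probability.RandomPlanarGeometry.ConformalRectangle, ∃ c : ℝ,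
      Tendsto (Literature.Probability.Percolation.bondDomainCrossingProb R) (𝓝[>] (0 : ℝ))
        (𝓝 c) := by
    intro R
    refine limitPayoff_exists_tendsto_of_cauchy _ fun ε hε => ?_
    obtain ⟨ℓ₀, hℓ₀, hℓ⟩ := hN R (ε / 2) (half_pos hε)
    obtain ⟨δ₀, hδ₀, hδ⟩ := hℓ (ℓ₀ / 2) (half_pos hℓ₀) (half_lt_self hℓ₀)
    exact ⟨δ₀, hδ₀, fun δ h1 h2 δ' h1' h2' =>
      limitPayoff_abs_sub_lt_of_near (hδ δ h1 h2) (hδ δ' h1' h2')⟩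
  choose Φ hΦ using hlim
  refine ⟨Φ, hΦ, ?_⟩
  -- Step 2: similarity invariance of the limit.
  intro R R' a w ha hc h0 h2
  have ha' : 0 < ‖a‖ := norm_pos_iff.2 ha
  have key : ∀ ε : ℝ, 0 < ε → |Φ R' - Φ R| ≤ 2 * ε := by
    intro ε hε
    obtain ⟨ℓ₀, hℓ₀, hℓ⟩ := hN R ε hε
    obtain ⟨ℓ₀', hℓ₀', hℓ'⟩ := hN R' ε hε
    -- a width `ℓ` with `ℓ < ℓ₀` and `‖a‖ * ℓ < ℓ₀'`
    obtain ⟨ℓ, hℓpos, hℓlt, haℓlt⟩ : ∃ ℓ : ℝ, 0 < ℓ ∧ ℓ < ℓ₀ ∧ ‖a‖ * ℓ < ℓ₀' := by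
      refine ⟨min (ℓ₀ / 2) (ℓ₀' / (2 * ‖a‖)), lt_min (half_pos hℓ₀) (by positivity),
        (min_le_left _ _).trans_lt (half_lt_self hℓ₀), ?_⟩
      calc ‖a‖ * min (ℓ₀ / 2) (ℓ₀' / (2 * ‖a‖))
          ≤ ‖a‖ * (ℓ₀' / (2 * ‖a‖)) := by gcongr; exact min_le_right _ _
        _ = ℓ₀' / 2 := by field_simp
        _ < ℓ₀' := half_lt_self hℓ₀'
    obtain ⟨δ₀, hδ₀, hδ⟩ := hℓ ℓ hℓpos hℓlt
    obtain ⟨δ₀', hδ₀', hδ'⟩ := hℓ' (‖a‖ * ℓ) (mul_pos ha' hℓpos) haℓlt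
    have b1 := limitPayoff_abs_sub_le_of_tendsto (hΦ R) hδ₀ hδ
    have b2 := limitPayoff_abs_sub_le_of_tendsto (hΦ R') hδ₀' hδ'
    rw [hE R R' a w ha hc h0 h2 ℓ hℓpos] at b2
    exact limitPayoff_abs_sub_le_two_mul b2 b1
  have h0 : |Φ R' - Φ R| ≤ 0 := by
    refine le_of_forall_pos_le_add fun ε hε => ?_
    have := key (ε / 2) (half_pos hε)
    linarith
  exact sub_eq_zero.1 (abs_nonpos_iff.1 h0)

end Summit.CriticalPhenomena.CardyFormulaZ2.Theorems.CardyWhiteToColoured
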